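import Summits.AtomisticToContinuum.Crystallization.Theorems.OverbindingBudgetMatchCompactness
import Summits.AtomisticToContinuum.Crystallization.Theorems.OverbindingBudgetPatchTransportTwo
import Summits.AtomisticToContinuum.Crystallization.Theorems.OverbindingBudgetRecurrentSealStatements

/-!
# OverbindingBudget — node «RecurrentSeal», limit closure of covering and of hull-stable sealing
(decomp-a2c lens 4, generation 21; helper `--supports stmt-AtomisticToContinuum-31280`; part of the node «RecurrentSeal», whose
statement and reading are in `…Theorems.OverbindingBudgetRecurrentSeal`)

§H `cleanT_of_match` (robust cleanness along a two-way matching about `0`, wrapper of `cleanT_transport₂`);  §I `solid_of_limit`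
(`9/10`-covering is limit-closed) and `wSeal_of_limit` (the hull-stable sealing condition `WSeal` is limit-closed: cleanness at every margin
`s < t` is transported along the matching with loss `3ε → 0`; a robust contact path in the limit transports back to the approximants at margin
`s − 3ε > 0`; the finitely many candidate partner pairs near `p` are pigeonholed along `ε → 0⁺`). [folklore techniques]
-/

noncomputable section

namespace Summit.AtomisticToContinuum.Crystallization.Theorems.OverbindingBudgetRecurrentSealClosure

open Filter Metric Set Topology
open Literature.MathematicalPhysics.StatisticalMechanics
open Literature.Geometry.DiscreteGeometry (ShellCloseTo fccKissingPattern hcpKissingPattern EtaMatched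
  card_eq_twelve_of_shellCloseTo)
open Summit.AtomisticToContinuum.Crystallization.Theorems.OverbindingBudgetWallTensionLever (CleanT TouchT Linked
  SealedDense MAT ThinCores BarlowClose SealedChargeLaw WallTension sealedChargeLaw_numerals_iff cube_subset_closedBall)
open Summit.AtomisticToContinuum.Crystallization.Theorems.OverbindingBudgetGradedBareness (cleanT_anti)
open Summit.AtomisticToContinuum.Crystallization.Theorems.OverbindingBudgetCleanlessCut (margin_le_of_cleanT)
open Summit.AtomisticToContinuum.Crystallization.Theorems.OverbindingBudgetExcessInstability (finite_inter_cube)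
open Summit.AtomisticToContinuum.Crystallization.Theorems.OverbindingBudgetMatchCompactness
open Summit.AtomisticToContinuum.Crystallization.Theorems.OverbindingBudgetPatchTransportTwo
open Summit.AtomisticToContinuum.Crystallization.Theorems.OverbindingBudgetRecurrentSealStatements

/-! ## §H  Transport along a two-way matching about `0` -/

/-- Robust cleanness crosses a two-way `ε`-matching `Match ε R 0 A B` from a site `y ∈ A` to a partner
`y' ∈ B` (`dist y y' ≤ ε`), margins `t ↦ t'` with `0 ≤ t'`, `t' + 2ε ≤ t`, `a t' + 2ε ≤ a t` (wrapper of
`cleanT_transport₂` with base points `0`). [folklore] -/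
theorem cleanT_of_match {A B : Set (EuclideanSpace ℝ (Fin 3))} {δ ε R a t t' : ℝ} {y y' : (EuclideanSpace ℝ (Fin 3))}
    (hsepA : ∀ x ∈ A, ∀ z ∈ A, x ≠ z → δ ≤ dist x z) (hsepB : ∀ x ∈ B, ∀ z ∈ B, x ≠ z → δ ≤ dist x z)
    (hε0 : 0 ≤ ε) (hεδ : 2 * ε < δ) (hm : Match ε R 0 A B) (ha : 0 < a) (hεa : 100 * ε ≤ a) (ht' : 0 ≤ t')
    (hhi : t ≤ a / 50) (htt : t' + 2 * ε ≤ t) (htta : a * t' + 2 * ε ≤ a * t) (hy : y ∈ A) (hy' : y' ∈ B)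
    (hyy' : dist y y' ≤ ε) (hR : ‖y‖ + 2 * a ≤ R) (hc : CleanT a t A y) : CleanT a t' B y' := by
  have hex₁ : ∀ w ∈ A, dist w 0 ≤ R → ∃ w' ∈ B, dist (w' - 0) (w - 0) ≤ ε := by
    intro w hw hwR
    obtain ⟨w', hw', hd⟩ := hm.2 w hw hwR
    exact ⟨w', hw', by rw [sub_zero, sub_zero, dist_comm]; exact hd⟩
  have hex₂ : ∀ w' ∈ B, dist w' 0 ≤ R → ∃ w ∈ A, dist (w' - 0) (w - 0) ≤ ε := by
    intro w' hw' hw'R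
    obtain ⟨w, hw, hd⟩ := hm.1 w' hw' hw'R
    exact ⟨w, hw, by rw [sub_zero, sub_zero, dist_comm]; exact hd⟩
  have hyy'' : dist (y' - 0) (y - 0) ≤ ε := by rw [sub_zero, sub_zero, dist_comm]; exact hyy'
  have hR' : dist y 0 + 2 * a ≤ R := by rw [dist_zero_right]; exact hR
  exact cleanT_transport₂ hsepA hsepB hε0 hεδ hex₁ hex₂ ha hεa (by linarith) hhi htt htta hy hy' hyy'' hR'
    (Or.inl ht') hc

/-! ## §I  Limit closure of the hull conditions -/

/-- `9/10`-covering passes to local limits. [folklore] -/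
theorem solid_of_limit {δ : ℝ} (hδ : 0 < δ) {Zs : ℕ → Set (EuclideanSpace ℝ (Fin 3))} {Z : Set (EuclideanSpace ℝ (Fin 3))}
    (hsep : ∀ p ∈ Z, ∀ q ∈ Z, p ≠ q → δ ≤ dist p q)
    (hconv : ∀ R ε : ℝ, 0 < ε → ∀ᶠ k in atTop, Match ε R 0 (Zs k) Z)
    (hsolid : ∀ k, ∀ z : (EuclideanSpace ℝ (Fin 3)), ∃ w ∈ Zs k, dist z w ≤ 9 / 10) : ∀ z : (EuclideanSpace ℝ (Fin 3)), ∃ w ∈ Z, dist z w ≤ 9 / 10 := by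
  intro z
  by_contra hno
  push Not at hno
  have hfin : (Z ∩ closedBall z 2).Finite := UniformlyDiscrete.finite_inter_closedBall (X := Z) ⟨δ, hδ, hsep⟩ z 2
  have h1 : ∀ᶠ ε in 𝓝[>] (0 : ℝ), ∀ s ∈ Z ∩ closedBall z 2, 9 / 10 + ε < dist z s := by
    refine hfin.eventually_all.2 fun s hs => ?_
    have hlt : (0 : ℝ) < dist z s - 9 / 10 := by linarith [hno s hs.1]
    exact ((eventually_lt_nhds hlt).filter_mono nhdsWithin_le_nhds).mono fun ε h => by linarith
  have h2 : ∀ᶠ ε in 𝓝[>] (0 : ℝ), ε < 1 := (eventually_lt_nhds one_pos).filter_mono nhdsWithin_le_nhds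
  have h3 : ∀ᶠ ε in 𝓝[>] (0 : ℝ), 0 < ε := eventually_mem_nhdsWithin
  obtain ⟨ε, hε1, hε2, hε3⟩ := (h1.and (h2.and h3)).exists
  obtain ⟨k, hk⟩ := (hconv (‖z‖ + 1) ε hε3).exists
  obtain ⟨w, hw, hzw⟩ := hsolid k z
  have hwR : dist w 0 ≤ ‖z‖ + 1 := by
    have := dist_triangle w z 0
    rw [dist_zero_right, dist_comm w z] at this
    rw [dist_zero_right] at this ⊢
    linarith
  obtain ⟨s, hs, hws⟩ := hk.2 w hw hwR
  have hzs : dist z s ≤ 9 / 10 + ε := by linarith [dist_triangle z w s]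
  have hs2 : s ∈ Z ∩ closedBall z 2 := ⟨hs, mem_closedBall.2 (by rw [dist_comm]; linarith)⟩
  linarith [hε1 s hs2]

/-- Hull-stable sealing passes to local limits (robust cleanness is transported ALONG the matching with a
margin loss `3ε → 0` absorbed by the open margin range `s < t`; a robust contact path in the limit would
transport BACK to the approximants at a smaller positive margin). [folklore] -/
theorem wSeal_of_limit {δ a t W : ℝ} {P : ℕ} {L : ℝ} (hδ : 0 < δ) (ha : 47 / 50 ≤ a) (ha1 : a ≤ 1)
    {Zs : ℕ → Set (EuclideanSpace ℝ (Fin 3))} {Z : Set (EuclideanSpace ℝ (Fin 3))} (hsepk : ∀ k, ∀ p ∈ Zs k, ∀ q ∈ Zs k, p ≠ q → δ ≤ dist p q)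
    (hsep : ∀ p ∈ Z, ∀ q ∈ Z, p ≠ q → δ ≤ dist p q)
    (hconv : ∀ R ε : ℝ, 0 < ε → ∀ᶠ k in atTop, Match ε R 0 (Zs k) Z)
    (hW : ∀ k, WSeal a t W P L (Zs k)) : WSeal a t W P L Z := by
  classical
  have ha0 : 0 < a := by linarith
  intro p hp
  set R₀ : ℝ := ‖p‖ + |L| + |W| + 2 * (P : ℝ) + 10 with hR₀
  have hP0 : (0 : ℝ) ≤ P := Nat.cast_nonneg P
  -- matchings at every precision
  have hk : ∀ ε : ℝ, ∃ k : ℕ, 0 < ε → Match ε R₀ 0 (Zs k) Z := by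
    intro ε
    by_cases hε : 0 < ε
    · obtain ⟨k, hk⟩ := (hconv R₀ ε hε).exists
      exact ⟨k, fun _ => hk⟩
    · exact ⟨0, fun h => absurd h hε⟩
  choose k hk using hk
  have hp0 : dist p 0 ≤ R₀ := by
    rw [dist_zero_right]; linarith [abs_nonneg L, abs_nonneg W, norm_nonneg p]
  -- partners of `p`, the sealed pairs near them, and their partners back in `Z`
  have hpn : ∀ ε : ℝ, ∃ q : (EuclideanSpace ℝ (Fin 3)), 0 < ε → q ∈ Zs (k ε) ∧ dist q p ≤ ε := by
    intro ε
    by_cases hε : 0 < ε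
    · obtain ⟨q, hq, hqd⟩ := (hk ε hε).1 p hp hp0
      exact ⟨q, fun _ => ⟨hq, hqd⟩⟩
    · exact ⟨0, fun h => absurd h hε⟩
  choose pn hpn using hpn
  have hpair : ∀ ε : ℝ, ∃ yy : (EuclideanSpace ℝ (Fin 3)) × (EuclideanSpace ℝ (Fin 3)), 0 < ε → (yy.1 ∈ Zs (k ε) ∧ yy.2 ∈ Zs (k ε) ∧
      dist yy.1 (pn ε) ≤ L ∧ (∀ s : ℝ, 0 < s → s < t → CleanT a s (Zs (k ε)) yy.1 ∧ CleanT a s (Zs (k ε)) yy.2) ∧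
      dist yy.1 yy.2 ≤ W ∧ ∀ s : ℝ, 0 < s → ¬ Linked a s P (Zs (k ε)) yy.1 yy.2) := by
    intro ε
    by_cases hε : 0 < ε
    · obtain ⟨y, hy, y', hy', h1, h2, h3, h4⟩ := hW (k ε) (pn ε) (hpn ε hε).1
      exact ⟨(y, y'), fun _ => ⟨hy, hy', h1, h2, h3, h4⟩⟩
    · exact ⟨(0, 0), fun h => absurd h hε⟩
  choose yy hyy using hpair
  have hp0' : dist p 0 = ‖p‖ := dist_zero_right p
  have hn1 : ∀ ε, 0 < ε → ε ≤ 1 → dist (yy ε).1 0 ≤ ‖p‖ + |L| + 1 := by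
    intro ε hε hε1
    obtain ⟨-, -, hd, -⟩ := hyy ε hε
    have h1 := dist_triangle (yy ε).1 (pn ε) 0
    have h2 := dist_triangle (pn ε) p 0
    linarith [le_abs_self L, abs_nonneg W, (hpn ε hε).2]
  have hn2 : ∀ ε, 0 < ε → ε ≤ 1 → dist (yy ε).2 0 ≤ ‖p‖ + |L| + |W| + 2 := by
    intro ε hε hε1
    obtain ⟨-, -, hd, -, hW', -⟩ := hyy ε hε
    have h1 := dist_triangle (yy ε).2 (yy ε).1 0
    have h2 := dist_triangle (yy ε).1 (pn ε) 0
    have h3 := dist_triangle (pn ε) p 0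
    have h4 := dist_comm (yy ε).2 (yy ε).1
    linarith [le_abs_self L, le_abs_self W, (hpn ε hε).2]
  have hzz : ∀ ε : ℝ, ∃ zz : (EuclideanSpace ℝ (Fin 3)) × (EuclideanSpace ℝ (Fin 3)), 0 < ε → ε ≤ 1 →
      (zz.1 ∈ Z ∧ dist (yy ε).1 zz.1 ≤ ε ∧ zz.2 ∈ Z ∧ dist (yy ε).2 zz.2 ≤ ε) := by
    intro ε
    by_cases hε : 0 < ε
    · by_cases hε1 : ε ≤ 1
      · obtain ⟨z, hz, hzd⟩ := (hk ε hε).2 _ (hyy ε hε).1 (by linarith [hn1 ε hε hε1, abs_nonneg W])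
        obtain ⟨z', hz', hz'd⟩ := (hk ε hε).2 _ (hyy ε hε).2.1 (by linarith [hn2 ε hε hε1])
        exact ⟨(z, z'), fun _ _ => ⟨hz, hzd, hz', hz'd⟩⟩
      · exact ⟨(0, 0), fun _ h => absurd h hε1⟩
    · exact ⟨(0, 0), fun h => absurd h hε⟩
  choose zz hzz using hzz
  -- the partners back in `Z` range over a finite set: pigeonhole along `ε → 0⁺`
  set S : Set (EuclideanSpace ℝ (Fin 3)) := Z ∩ closedBall p (|L| + |W| + 4) with hS
  have hSfin : S.Finite := UniformlyDiscrete.finite_inter_closedBall (X := Z) ⟨δ, hδ, hsep⟩ p (|L| + |W| + 4)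
  have hzzS : ∀ ε, 0 < ε → ε ≤ 1 → zz ε ∈ S ×ˢ S := by
    intro ε hε hε1
    obtain ⟨hz, hzd, hz', hz'd⟩ := hzz ε hε hε1
    obtain ⟨-, -, hd, -, hW', -⟩ := hyy ε hε
    have hq := (hpn ε hε).2
    refine ⟨⟨hz, mem_closedBall.2 ?_⟩, ⟨hz', mem_closedBall.2 ?_⟩⟩
    · have h1 := dist_triangle (zz ε).1 (yy ε).1 p
      have h2 := dist_triangle (yy ε).1 (pn ε) p
      have h3 := dist_comm (zz ε).1 (yy ε).1
      linarith [le_abs_self L, abs_nonneg W]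
    · have h1 := dist_triangle (zz ε).2 (yy ε).2 p
      have h2 := dist_triangle (yy ε).2 (yy ε).1 p
      have h3 := dist_triangle (yy ε).1 (pn ε) p
      have h4 := dist_comm (zz ε).2 (yy ε).2
      have h5 := dist_comm (yy ε).2 (yy ε).1
      linarith [le_abs_self L, le_abs_self W]
  obtain ⟨q, hqS, hfreq⟩ : ∃ q ∈ S ×ˢ S, ∃ᶠ ε in 𝓝[>] (0 : ℝ), zz ε = q := by
    by_contra hno
    push Not at hno
    have h1 : ∀ᶠ ε in 𝓝[>] (0 : ℝ), ∀ q ∈ S ×ˢ S, zz ε ≠ q :=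
      (hSfin.prod hSfin).eventually_all.2 fun q hq => hno q hq
    have h2 : ∀ᶠ ε in 𝓝[>] (0 : ℝ), ε < 1 := (eventually_lt_nhds one_pos).filter_mono nhdsWithin_le_nhds
    have h3 : ∀ᶠ ε in 𝓝[>] (0 : ℝ), 0 < ε := eventually_mem_nhdsWithin
    obtain ⟨ε, hε1, hε2, hε3⟩ := (h1.and (h2.and h3)).exists
    exact hε1 (zz ε) (hzzS ε hε3 hε2.le) rfl
  have hsmall : ∀ ε₀ : ℝ, 0 < ε₀ → ∃ ε : ℝ, 0 < ε ∧ ε < ε₀ ∧ ε ≤ 1 ∧ zz ε = q := by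
    intro ε₀ hε₀
    have h2 : ∀ᶠ ε in 𝓝[>] (0 : ℝ), ε < ε₀ := (eventually_lt_nhds hε₀).filter_mono nhdsWithin_le_nhds
    have h2' : ∀ᶠ ε in 𝓝[>] (0 : ℝ), ε < 1 := (eventually_lt_nhds one_pos).filter_mono nhdsWithin_le_nhds
    have h3 : ∀ᶠ ε in 𝓝[>] (0 : ℝ), 0 < ε := eventually_mem_nhdsWithin
    obtain ⟨ε, hz, hlt, hlt1, hpos⟩ := (hfreq.and_eventually (h2.and (h2'.and h3))).exists
    exact ⟨ε, hpos, hlt, hlt1.le, hz⟩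
  obtain ⟨hq1S, hq2S⟩ := hqS
  have hq1 : ‖q.1‖ ≤ ‖p‖ + |L| + |W| + 4 := by
    have h := mem_closedBall.1 hq1S.2
    have := norm_le_insert' q.1 p
    rw [← dist_eq_norm] at this
    linarith
  -- the pair `q = (y, y')` seals `p` in the limit
  refine ⟨q.1, hq1S.1, q.2, hq2S.1, ?_, ?_, ?_, ?_⟩
  · -- distance to `p`
    refine le_of_forall_pos_lt_add fun τ hτ => ?_
    obtain ⟨ε, hε, hετ, hε1, hzq⟩ := hsmall (τ / 2) (by linarith)
    obtain ⟨hz, hzd, -, -⟩ := hzz ε hε hε1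
    obtain ⟨-, -, hd, -⟩ := hyy ε hε
    rw [hzq] at hzd
    have h1 := dist_triangle q.1 (yy ε).1 p
    have h2 := dist_triangle (yy ε).1 (pn ε) p
    have h3 := dist_comm q.1 (yy ε).1
    linarith [(hpn ε hε).2]
  · -- robust cleanness at every margin `s < t`
    intro s hs hst
    obtain ⟨ε, hε, hεs, hε1, hzq⟩ := hsmall (min ((t - s) / 3) (min (δ / 4) (1 / 200))) (by positivity)
    have hε3 : 3 * ε < t - s := by
      have := min_le_left ((t - s) / 3) (min (δ / 4) (1 / 200)); linarith
    have hεδ : 2 * ε < δ := by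
      have := (min_le_right ((t - s) / 3) (min (δ / 4) (1 / 200))).trans (min_le_left _ _); linarith
    have hεa : 100 * ε ≤ a := by
      have := (min_le_right ((t - s) / 3) (min (δ / 4) (1 / 200))).trans (min_le_right _ _); linarith
    obtain ⟨hz, hzd, hz', hz'd⟩ := hzz ε hε hε1
    obtain ⟨hy, hy', -, hcl, -, -⟩ := hyy ε hε
    rw [hzq] at hz hzd hz' hz'd
    have hcs := hcl (s + 3 * ε) (by linarith) (by linarith)
    have hhi : s + 3 * ε ≤ a / 50 := margin_le_of_cleanT hcs.1
    have htta : a * s + 2 * ε ≤ a * (s + 3 * ε) := by nlinarith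
    have hR1 : ‖(yy ε).1‖ + 2 * a ≤ R₀ := by
      have := hn1 ε hε hε1; rw [dist_zero_right] at this; linarith [abs_nonneg W]
    have hR2 : ‖(yy ε).2‖ + 2 * a ≤ R₀ := by
      have := hn2 ε hε hε1; rw [dist_zero_right] at this; linarith
    have htt : s + 2 * ε ≤ s + 3 * ε := by linarith
    exact ⟨cleanT_of_match (hsepk _) hsep hε.le hεδ (hk ε hε) ha0 hεa hs.le hhi htt htta hy hz hzd hR1 hcs.1,
      cleanT_of_match (hsepk _) hsep hε.le hεδ (hk ε hε) ha0 hεa hs.le hhi htt htta hy' hz' hz'd hR2 hcs.2⟩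
  · -- width
    refine le_of_forall_pos_lt_add fun τ hτ => ?_
    obtain ⟨ε, hε, hετ, hε1, hzq⟩ := hsmall (τ / 2) (by linarith)
    obtain ⟨hz, hzd, hz', hz'd⟩ := hzz ε hε hε1
    obtain ⟨-, -, -, -, hW', -⟩ := hyy ε hε
    rw [hzq] at hzd hz'd
    have h1 := dist_triangle q.1 (yy ε).1 q.2
    have h2 := dist_triangle (yy ε).1 (yy ε).2 q.2
    have h3 := dist_comm q.1 (yy ε).1
    linarith
  · -- no robust contact path: it would transport back to the approximants
    intro s hs hL
    obtain ⟨n, hn, z, hz0, hzn, hcl, hto⟩ := hL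
    have hs50 : s ≤ a / 50 := margin_le_of_cleanT (hcl 0 (Nat.zero_le n)).2
    obtain ⟨ε, hε, hεs, hε1, hzq⟩ := hsmall (min (s / 4) (min (δ / 4) (1 / 200))) (by positivity)
    have hε4 : 4 * ε < s := by
      have := min_le_left (s / 4) (min (δ / 4) (1 / 200)); linarith
    have hεδ : 2 * ε < δ := by
      have := (min_le_right (s / 4) (min (δ / 4) (1 / 200))).trans (min_le_left _ _); linarith
    have hεa : 100 * ε ≤ a := by
      have := (min_le_right (s / 4) (min (δ / 4) (1 / 200))).trans (min_le_right _ _); linarith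
    obtain ⟨hzq1, hzd1, hzq2, hzd2⟩ := hzz ε hε hε1
    obtain ⟨hy, hy', -, -, -, hnl⟩ := hyy ε hε
    rw [hzq] at hzd1 hzd2
    -- norms along the path
    have hnorm : ∀ i, i ≤ n → ‖z i‖ ≤ ‖q.1‖ + 2 * i := by
      intro i
      induction i with
      | zero => intro _; rw [hz0]; simp
      | succ j ih =>
        intro hj
        have hj' : j < n := Nat.lt_of_succ_le hj
        have h1 := ih hj'.le
        have h2 := (hto j hj').2
        have h3 := norm_le_insert' (z (j + 1)) (z j)
        rw [← dist_eq_norm, dist_comm] at h3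
        push_cast
        nlinarith [h1, h2, h3, hs.le]
    have hzR : ∀ i, i ≤ n → ‖z i‖ + 2 * a ≤ R₀ := by
      intro i hi
      have h1 := hnorm i hi
      have h2 : (i : ℝ) ≤ P := by exact_mod_cast hi.trans hn
      linarith
    -- partners of the path sites in the approximant
    have hpart : ∀ i : ℕ, ∃ w : (EuclideanSpace ℝ (Fin 3)), i ≤ n → w ∈ Zs (k ε) ∧ dist (z i) w ≤ ε := by
      intro i
      by_cases hi : i ≤ n
      · have hi0 : dist (z i) 0 ≤ R₀ := by rw [dist_zero_right]; linarith [hzR i hi]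
        obtain ⟨w, hw, hwd⟩ := (hk ε hε).1 (z i) (hcl i hi).1 hi0
        exact ⟨w, fun _ => ⟨hw, by rw [dist_comm]; exact hwd⟩⟩
      · exact ⟨0, fun h => absurd h hi⟩
    choose z' hz' using hpart
    have hlink : Linked a (s - 3 * ε) P (Zs (k ε)) (yy ε).1 (yy ε).2 := by
      refine ⟨n, hn, z', ?_, ?_, fun i hi => ⟨(hz' i hi).1, ?_⟩, fun i hi => ?_⟩
      · by_contra hne
        have hδle := hsepk (k ε) (z' 0) (hz' 0 (Nat.zero_le n)).1 (yy ε).1 hy hne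
        have h1 := (hz' 0 (Nat.zero_le n)).2
        rw [hz0] at h1
        have : dist (z' 0) (yy ε).1 ≤ ε + ε :=
          (dist_triangle (z' 0) q.1 (yy ε).1).trans
            (add_le_add (by rw [dist_comm]; exact h1) (by rw [dist_comm]; exact hzd1))
        linarith
      · by_contra hne
        have hδle := hsepk (k ε) (z' n) (hz' n le_rfl).1 (yy ε).2 hy' hne
        have h1 := (hz' n le_rfl).2
        rw [hzn] at h1
        have : dist (z' n) (yy ε).2 ≤ ε + ε :=
          (dist_triangle (z' n) q.2 (yy ε).2).trans
            (add_le_add (by rw [dist_comm]; exact h1) (by rw [dist_comm]; exact hzd2))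
        linarith
      · have htta : a * (s - 3 * ε) + 2 * ε ≤ a * s := by nlinarith
        exact cleanT_of_match hsep (hsepk _) hε.le hεδ (hk ε hε).symm ha0 hεa (by linarith) hs50 (by linarith)
          htta (hcl i hi).1 (hz' i hi).1 (hz' i hi).2 (hzR i hi) (hcl i hi).2
      · have hi1 : i + 1 ≤ n := hi
        obtain ⟨hne, hd⟩ := hto i hi
        have h1 := (hz' i hi.le).2
        have h2 := (hz' (i + 1) hi1).2
        have hδle := hsep (z i) (hcl i hi.le).1 (z (i + 1)) (hcl (i + 1) hi1).1 hne
        have hup : dist (z' i) (z' (i + 1)) ≤ dist (z i) (z (i + 1)) + (ε + ε) := by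
          have h3 := dist_triangle (z' i) (z i) (z' (i + 1))
          have h4 := dist_triangle (z i) (z (i + 1)) (z' (i + 1))
          have h5 := dist_comm (z' i) (z i)
          linarith
        have hlow : dist (z i) (z (i + 1)) ≤ dist (z' i) (z' (i + 1)) + (ε + ε) := by
          have h3 := dist_triangle (z i) (z' i) (z (i + 1))
          have h4 := dist_triangle (z' i) (z' (i + 1)) (z (i + 1))
          have h5 := dist_comm (z' (i + 1)) (z (i + 1))
          linarith
        refine ⟨fun heq => ?_, by linarith⟩
        rw [heq, dist_self] at hlow
        linarith
    exact hnl (s - 3 * ε) (by linarith) hlink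

end Summit.AtomisticToContinuum.Crystallization.Theorems.OverbindingBudgetRecurrentSealClosure

end
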